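import Summits.CriticalPhenomena.PercolationContinuityZ3.Theorems.Transplant.SkelPhiFaceDataNT
import Summits.CriticalPhenomena.PercolationContinuityZ3.Theorems.Transplant.SkelPhiFaceDataN
import Summits.CriticalPhenomena.PercolationContinuityZ3.Theorems.Transplant.SkelPhiFaceCellRead
import Literature.Probability.Percolation.OrientedHistorySiteRenormalizationRun
import Summits.CriticalPhenomena.PercolationContinuityZ3.Theorems.Transplant.PlanarCells2TDefs
import HarnessLib
/-!
(R-40) SUCCESSOR `…T` (hp-8 g42, 2026-08-23; ruling p3-g16 06:23:56Z, J18): the twin of `SkelPhiFaceCellReadS` over the PER-AXIS creep cap `PCells2T` (PlanarCells2TDefs: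
`c i ≤ r (oth i)` instead of the uniform `c i ≤ cmax ≤ r j`); statements and proofs VERBATIM with `PCells2S ↦ PCells2T` (+ the renames of record of the T layer below it);
the only mathematical touch points are the places that read the cap, which only ever need the cross form `c (oth j) ≤ r j` (listed in the lane line of this file's landing).
NO landed file is edited; `SkelPhiFaceCellReadS` stays valid (and is an instance of this file through `PCells2S.toT`). NON-VACUITY: inherited verbatim from `SkelPhiFaceCellReadS` (same witness line).

# N2 (frames-only node `SamePDropOfSkeletonFrm₁`, OPEN) — WAVE 1, (F) face-data column over STAGGERED cells ((R-22) `PCells2T`, (R-28)(β) one landing per file): the twin of N1's `SkelPhiFaceCellRead`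

builds on p205010 (kernel theorem, internal audit signed; external expert review pending) — nothing in this file uses p205010; NOTHING is claimed about the
open node `SamePDropOfSkeletonFrm₁` (`SamePDropOfSkeletonNeg₁` is CLOSED in the tree and untouched by this file).
Status sentence (coordinator 2026-08-20T04:30Z): "θ(p_c) = 0 on ℤ^d, all d ≥ 2 — kernel-verified (Lean 4/Mathlib, standard axioms); internal adversarial
audit SIGNED 2026-08-20 04:29Z; external expert review pending."
Lane `prim-bschramm`, seat `prim-hp-8` (gen 40); helper file (`--supports stmt-CriticalPhenomena-4575 --as helper`); design owner p3-g15 ((R-22) staggered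
cells `PCells2T`, (R-27)/(R-29) far regions of record `FarNS/FarNS₂`, (R-28)(β), naming 2026-08-22T23:00:04Z: suffix `S`).
PORT RULES (HOME/prim-hp-8/code/gen40/orient/bin/port_s.py = stmt-g19's port_orient.py + the G token table): the cells are `P : PCells2T`, every box is
read about the STAGGERED centre `cenS` (`PlanarCells2SDefs/SFar/ContainS/SArm/SepS/SepInfS/LevelsS/EfarN2S`), the scheme record is `cellGeomSG₂T`/`cellGeomSG₂bT`
(`SkelPhiCellsWeakGS/…SmallMS`: narrow arm `BtwNS`, two-block far region `FarNS₂`), the history-site API is the ORIENTED one at `qNE` where it occurs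
(`ochoice qNE`, `onwardO`, `Valid₂O`, `IsRun₂O`, …, (R-18)); EVERY declaration is re-declared with the suffix `S` (same namespace). Docstrings/citations are N1's.
N1 HEADER (kept for the reader):
* `PCells2.lev_faceLo`, **`Skelφ.cell_of_frame_box`**.
[cite: KozmaNitzan2024, §4 p. 30 (Step III: F^{j+1})] [cite: Timar2007, Lemma 2.2, p. 3]
-/
noncomputable section

open scoped Classical

namespace Summit.CriticalPhenomena.PercolationContinuityZ3.Theorems.Transplant

open Literature.Probability.Percolation Literature.Probability.LatticeModels KNCells
open Literature.Probability.Percolation.KozmaNitzan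
open Literature.Probability.Percolation.KozmaNitzan.Cells (oth oth_ne sgOf sgOf_sign eq_oth_of_ne oth_oth)

/-- The lower corner of the face row has planar level `faceL`. [folklore] -/
theorem PCells2T.lev_faceLo (P : PCells2T) (x : Site 2) (du : MDir) (j : ℕ) : P.lev du x (P.faceLo x du j) = P.faceL du.1 j := by
  unfold PCells2T.lev PCells2T.faceLo
  rcases sgOf_sign du with h | h
  · simp only [sLo, if_true, h]; ring
  · simp only [sLo, if_true, h, show (-1 : ℤ) ≠ 1 by norm_num, if_false]; ring

namespace Skelφ

variable {V : Type} {φ : V → Site 2}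

/-- **THE CONTACT'S CELL FROM THE FRAME BOX**: planar level within `E` of the face level, transverse cell offset at most `k_E`.
[cite: KozmaNitzan2024, §4 p. 30 (Step III)] -/
theorem cell_of_frame_boxT (pr : FinePrm) (w₀ : V) (hc₀ : 0 < pr.c₀) (hc₁ : 0 < pr.c₁) (hD : 0 < pr.D) (P : PCells2T) {x : Site 2} {du : MDir}
    {j : ℕ} {b : Fin 2} (hnz : pr.lvGen du.1 b ≠ 0) {pc : ℤ} {aw E : ℕ} {yF : V} (hyF : pr.ψ φ w₀ yF = P.faceCen x du j)
    (hpc : pc = relφ φ w₀ yF b) {kE : ℤ} (hroom : pr.Mabs * (aw + E) + pr.rdN du.1 b * (E + 1) * pr.D ≤ pr.rdK du.1 b * kE * pr.D) {c : V}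
    (hbox : pr.frame φ w₀ du.1 b c ∈ Finset.Icc (loNT P x du j pc aw - ((E : ℕ) : Site 2)) (hiNT P x du j pc aw + ((E : ℕ) : Site 2))) :
    (P.faceL du.1 j : ℤ) - E ≤ P.lev du x (pr.ψ φ w₀ c) ∧ P.lev du x (pr.ψ φ w₀ c) ≤ P.faceL du.1 j + E ∧
      |pr.ψ φ w₀ c (oth du.1) - P.cenS x (oth du.1)| ≤ kE := by
  rw [Finset.mem_Icc] at hbox
  obtain ⟨hlo, hhi⟩ := hbox
  have hl1 := hlo du.1
  have hl2 := hhi du.1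
  have hr1 := hlo (oth du.1)
  have hr2 := hhi (oth du.1)
  simp only [loNT, hiNT, Pi.sub_apply, Pi.add_apply, Pi.natCast_apply, if_true, if_neg (oth_ne du.1)] at hl1 hl2 hr1 hr2
  rw [← P.faceLo_fst_eq_faceHi_fst] at hl2
  rw [pr.frame_apply_lv] at hl1 hl2
  rw [pr.frame_apply_raw] at hr1 hr2
  -- the planar level
  have hlev : P.lev du x (pr.ψ φ w₀ c) = P.faceL du.1 j + sgOf du * (pr.ψ φ w₀ c du.1 - P.faceLo x du j du.1) := by
    rw [← P.lev_faceLo x du j]; unfold PCells2T.lev; ring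
  have hσ := sgOf_sign du
  refine ⟨?_, ?_, ?_⟩
  · rw [hlev]; rcases hσ with h | h <;> rw [h] <;> linarith
  · rw [hlev]; rcases hσ with h | h <;> rw [h] <;> linarith
  · -- the transverse cell coordinate by inverse reading against `yF`
    have hyI : pr.ψ φ w₀ yF du.1 = P.faceLo x du j du.1 := by rw [hyF, P.faceCen_apply_fst]
    have hyO : pr.ψ φ w₀ yF (oth du.1) = P.cenS x (oth du.1) := by rw [hyF, P.faceCen_apply_oth]
    have ha : |relφ φ w₀ c b - relφ φ w₀ yF b| ≤ aw + E := by
      rw [← hpc]; exact abs_le.2 ⟨by linarith, by linarith⟩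
    have hd : |pr.ψ φ w₀ c du.1 - pr.ψ φ w₀ yF du.1| ≤ E := by
      rw [hyI]; exact abs_le.2 ⟨by linarith, by linarith⟩
    have hk := pr.read_oth w₀ hc₀ hc₁ hD du.1 b hnz ha hd (k := kE) (by linarith)
    rwa [hyO] at hk

end Skelφ

end Summit.CriticalPhenomena.PercolationContinuityZ3.Theorems.Transplant

end
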